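/-
Copyright: lit-balaban cell, Phase-2 proof seat p11 (gen 3).  Statement-level skeleton of a published paper; no proof claims beyond
what the kernel checks below.
-/
import Literature.MathematicalPhysics.QuantumFieldTheory.BalabanImbrieJaffe1984to88.BIJ85ScalarPropagatorTorus

/-!
# `BalabanImbrieJaffe1984to88.BIJ85BlockAveragesTorusK` — T. Bałaban, J. Imbrie, A. Jaffe, *Renormalization of the Higgs model:
minimizers, propagators and the stability of mean field theory*, Commun. Math. Phys. **97** (1985) 299–329
[BalabanImbrieJaffe1985]: the **k-LEVEL covariant scalar block average `Q_k(u)`** of Sect. 4.6 p. 313 (4.6.1)–(4.6.4) — the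
`k`-fold composition of the one-step averages **(2.6)** p. 303 along the composite contours **(5.1.2)–(5.1.3)** p. 313–314 —
ON THE TORUS CARRIER OF RECORD, with the closed formula *"(2.6) with `L` replaced by `L^k`"* and **(2.8)** at level `k` PROVED

statement-level skeleton of published theorems with citation tags; proofs where landed; nothing here is a claim about the Yang–Mills mass gap

PDF held: `paper:balaban1985-cmp97-bij-higgs-minimizers` (journal page = PDF page + 298).  Pages read this session (`lit read`, OCR
text): p. 302–304 [PDF 4–6] ((2.4)–(2.6), (2.13)), p. 309 [PDF 11] (the sentence after (4.1.1)), p. 313–314 [PDF 15–16] ((4.6.1)–(4.6.4),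
(5.1.2)–(5.1.3)).

CITATION HEADER (lean-in-tree rule).  Phase-2 file of the lit-balaban TYPED SKELETON (HOME `run/shared/lean/pub/lit-balaban/`), seat
p11 gen 3 (unit `lit-balaban-p11-g3`; TAKING line HOME/STATUS.md 2026-08-21T05:02:42Z; owner r15, referee ref-5): the carrier half
of the GENERAL-`k` torus model instance of rows **C1.Eq4.6.1** / **C1.Eq4.6.2-4.6.4** (the gen-2 instance `BIJ85ScalarPropagatorTorus`
was ONE averaging level, its header: *"Scope (F6): one averaging level … the k-level average Q_k(u) along the composed contours is not
typed on the torus"*).  The theorems (no zero modes of `−Δ_u + aQ_k(u)^*Q_k(u)`, (4.6.1)/(4.6.2)/ψ_k/(3.28)/(4.6.4) at level `k`) are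
the sibling `BIJ85ScalarPropagatorTorusK` (theorems only).

THE PRINTED TEXT, verbatim.  p. 303 [PDF 5]: *"For a point y′ which is a corner of an adjacent block, let Γ_{yy′} denote the L-lattice
bond from y to y′. The average Qφ of φ is defined by (Qφ)_y = L^{−d} Σ_{x∈B(y)} u(Γ_{yx})φ_x. (2.6) … Clearly (Qφ)^h = Qφ^h. (2.8) …
In the axial gauge, Qφ reduces to the ordinary average of φ"*; p. 302 [PDF 4]: *"define u(Γ) = Π_{b∈Γ} u_b. (2.5) Contours Γ₁, Γ₂
can be composed if the endpoint of Γ₂ coincides with the starting point of Γ₁, so u(Γ₁∘Γ₂) = u(Γ₁)u(Γ₂)"*; p. 309 [PDF 11]: *"The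
averaging operator Q_k is the k-fold composition of the 1-step averaging operators Q for bond variables, Q_k = (Q)^k. It follows that
Q_k is given by the formula (2.13), where L is replaced by L^k"*; p. 313–314 [PDF 15–16]: *"G_k(u_k) = [−Δ_{u_k} + a_kQ_k^*(u_k)Q_k(u_k)]^{−1},
(4.6.2) … ψ_k = a_kG_k(u_k)Q_k^*(u_k)ψ … we choose a sequence of points x₀, …, x_k, where x = x₀, y = x_k, and where x ∈ B^j(x_j),
x_j ∈ T^{(j)}_{L^jη}, (5.1.2) that is x_j ∈ B(x_{j+1}). (5.1.3) The contour Γ_{x_k,x} runs from x to x₁ in B(x₁), from x₁ to x₂ in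
B(x₂), etc."*.

WHAT IS DEFINED (defs with bodies) / PROVED (0 `sorry`, standard axioms, no `def … : Prop`).  Carriers of record only: the tori
`Balaban1983to89.Site P j` of `Setup` (the `η`-lattice of Sect. 4.6 is level `j`, the unit lattice is level `j + k`), bonds `PBond P j`,
`U(1)` fields `GaugeField P j U1` (`BIJ88Sect3Statements.U1`, read in `ℂ` by `toC`), scalar fields `BIJ85Sect1Model.HiggsField`; ALL the
one-level geometry is r18's `BIJ85BlockAveragesTorus` BY NAME (`corner`, `runBond`/`runSite`/`runC`, `holC` = `u(Γ_{yx})`, `qCov` = (2.6),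
`corner_shift` = *"Γ_{yy′} is the run of L unit bonds from the corner"*) — nothing of it is re-declared.
* §1 **`lineU U`** = `u(Γ_{yy′})` ∈ `U(1)` for the `L`-lattice bond `⟨y, y′ = y + e_μ⟩`: the ORDERED PRODUCT (2.5) of the bond variables
  over the `L` unit bonds of the straight run from the corner `y` (`runProd`; `toC_lineU`: `= runC U (corner y) μ`).  This is the gauge
  field the NEXT averaging level transports with: the segment `Γ_{x_{i+1},x_i}` of the composite contour (5.1.3) is a standard contour of
  the `L^iη`-lattice, each of whose bonds is a run of `L` bonds of the `L^{i−1}η`-lattice.  `lineIter U i` = the `i`-th iterate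
  (`u` on the bonds of `T^{(j+i)}`).  (2.7) passes to the runs: `lineU (u^h) = (lineU u)^{h∘corner}` (`lineU_gaugeAct`, from r18's
  `runC_gaugeAct`), `lineIter_gaugeAct`.
* §2 the block points **(5.1.2)–(5.1.3)** `blkIter k x = x_k ∈ T^{(j+k)}` (`x_{i+1} = blockOf x_i`), the iterated blocks
  `blockK k y = B^k(y) = {x | x_k = y}` with `B^{k+1}(y) = ⋃_{z∈B(y)} B^k(z)` (`blockK_succ`) and **`|B^k(y)| = L^{kd}`** (`card_blockK`),
  and `cornerIter k y` = the site `y ∈ T^{(j+k)}` regarded in `T^{(j)}` (corner of corner …; `blkIter_cornerIter`: it lies in `B^k(y)`).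
* §3 the composite transport **`holCK U k x = u(Γ^{(k)}_{x_k,x}) = u^{(k−1)}(Γ_{x_k x_{k−1}})⋯u^{(1)}(Γ_{x₂x₁})u(Γ_{x₁x})`** ((2.5) along
  (5.1.3); `|·| = 1`, `≠ 0`) and **`qCovK U k` = `Q_k(u)` := `Q(u^{(k−1)}) ∘ ⋯ ∘ Q(u^{(1)}) ∘ Q(u)`** (p. 309 *"the k-fold composition of
  the 1-step averaging operators"*), `HiggsField P j → HiggsField P (j+k)`; `qCovK U 1 = qCov U` (`qCovK_one`).  PROVED:
  **`qCovK_apply`** — *"Q_k is given by the formula …, where L is replaced by L^k"*: `(Q_k(u)φ)(y) = L^{−kd} Σ_{x∈B^k(y)} u(Γ^{(k)}_{yx})φ(x)`;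
  **(2.8) at level `k`** `Q_k(u^h)φ^h = h(y)·Q_k(u)φ` with `h` read at the corner point of `y` (`qCovK_gaugeAct`); p. 303 *"In the axial
  gauge, Qφ reduces to the ordinary average"* at level `k`: if every `u^{(i)}`, `i < k`, is `1` on the tree bonds (r18's `DeltaAx`) then
  `Q_k(u)φ = L^{−kd}Σ_{x∈B^k(y)}φ(x)` (`qCovK_of_deltaAx`).
* §4 `Q_k(u)` as a real-linear map of the finite-dimensional `ℓ²` spaces of `BIJ85ScalarPropagatorTorus` (`CoarseSpK P j k` = fields on
  `T^{(j+k)}`, `QlinK U k : FineSp P j →ₗ[ℝ] CoarseSpK P j k`, `QlinK U 1 = Qlin U`), with `‖Q_k(u)φ − ψ‖² = Σ_y|(Q_k(u)φ)(y) − ψ(y)|²`.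
Honest scope.  The B1-carrier version of the same objects (`Balaban1983to89.HiggsAveraging.avgQk`, composition `HiggsAveragingCompose.avgQ_avgQk`,
typer/r14) lives on the `HiggsLattice` tori with Lie-algebra transports `U(A(Γ))`; no bridge is built here (different `Params`).  The gauge-FIELD
average `Q_k` of (2.13)/(4.1.2) (bond variables) is r18's/p35's/p33's business (`LatticeFieldCalculus`, `B4Eq15Projection`, `BIJ85NoZeroModes309Torus`).

v1.1 (append-only, same seat; no v1 declaration changed): §5 — **(2.9) `Q_kQ_k^* = I` at level `k`**: r15's two-scale cell geometry
`BIJ85CellAverages.Cells` instantiated at block size `L^k` (`torusCellsK`: fine cells `Site P j`, coarse cells `Site P (j+k)`, `cell x = x_k`,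
`m = 0`), `qCovK = Cells.Qcov` with the unit transports `holCKCircle U k x = u(Γ^{(k)}_{yx}) ∈ U(1)` (`qCovK_eq_cellsQcov`), hence (2.9)
`qCovK_qCovKStar` (from r15's `Cells.Qcov_QcovStar` and `|B^k(y)| = (L^k)^d`) and the adjointness `inner_qCovK_eq_inner_qCovKStar` for the
weights (2.2) — the level-`k` twin of r18's v1.1 §8 (`torusCells`, `qCov_qCovStar`).
-/

open scoped BigOperators
open Finset

namespace Literature.MathematicalPhysics.QuantumFieldTheory.BalabanImbrieJaffe1984to88.BIJ85BlockAveragesTorusK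

open Literature.MathematicalPhysics.QuantumFieldTheory.Balaban1983to89
open BIJ88Sect3Statements (U1 toC toC_mul toC_one)
open BIJ88Sect3Rescaling (toC_injective_U1)
open BIJ85Sect1Model (HiggsField)
open BIJ88RenormTransf311 (DeltaAx)
open BIJ85BlockAveragesTorus BIJ85ScalarPropagatorTorus
open GaugeField (gaugeAct)

noncomputable section

variable {P : Params} {j : ℕ}

/-! ## §1 `u(Γ_{yy′})`: the `L`-lattice bond as the straight run of `L` unit bonds from the corner; iterates -/

/-- The ordered product `u(b₀)u(b₁)⋯u(b_{n−1})` (2.5) of the bond variables along the first `n` unit bonds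
`b_t = ⟨x + te_μ, x + (t+1)e_μ⟩` (r18's `runBond`) of the straight run from `x` in direction `μ`. [cite: BalabanImbrieJaffe1985, (2.5) p.302] -/
def runProd (U : GaugeField P j U1) (x : Balaban1983to89.Site P j) (μ : Fin P.d) : ℕ → U1
  | 0 => 1
  | n + 1 => runProd U x μ n * U (runBond x μ n)

/-- kernel: the ordered product read in `ℂ` is the product of the bond variables read in `ℂ`. [cite: BalabanImbrieJaffe1985, (2.5) p.302] -/
theorem toC_runProd (U : GaugeField P j U1) (x : Balaban1983to89.Site P j) (μ : Fin P.d) :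
    ∀ n : ℕ, toC (runProd U x μ n) = ∏ t ∈ range n, toC (U (runBond x μ t))
  | 0 => by rw [runProd, toC_one, prod_range_zero]
  | n + 1 => by rw [runProd, toC_mul, toC_runProd U x μ n, prod_range_succ]

/-- **`u(Γ_{yy′}) ∈ U(1)`** for the `L`-lattice bond `c = ⟨y, y′ = y + e_μ⟩` (p. 303 *"let Γ_{yy′} denote the L-lattice bond from y to
y′"*): as a contour of the unit lattice `Γ_{yy′}` is the straight run of `L` unit bonds from the corner `y` to the corner `y′` (r18's
`corner_shift`), and `u(Γ_{yy′}) = Π_{b∈Γ_{yy′}} u_b` (2.5) — the `U(1)` field on the `L`-lattice bonds with which the NEXT averaging level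
transports along the composite contours (5.1.3). [cite: BalabanImbrieJaffe1985, (2.5) p.302] -/
def lineU (U : GaugeField P j U1) : GaugeField P (j+1) U1 := fun c => runProd U (corner c.src) c.dir P.L

/-- kernel: `u(Γ_{yy′})` read in `ℂ` is r18's run transport `runC U (corner y) μ`. [cite: BalabanImbrieJaffe1985, (2.5) p.302] -/
theorem toC_lineU (U : GaugeField P j U1) (c : PBond P (j+1)) : toC (lineU U c) = runC U (corner c.src) c.dir :=
  toC_runProd U _ _ P.L

/-- **(2.7) passes to the runs**: `u^h(Γ_{yy′}) = h(y)u(Γ_{yy′})h(y′)^{−1}`, i.e. `lineU (u^h)` is the gauge transform of `lineU u` by `h`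
read at the block corners (standing range; r18's `runC_gaugeAct` + `corner_shift`). [cite: BalabanImbrieJaffe1985, (2.8) p.303] -/
theorem lineU_gaugeAct (hj : j + 1 ≤ P.m + P.K) (h : GaugeTransf P j U1) (U : GaugeField P j U1) :
    lineU (gaugeAct h U) = gaugeAct (fun y => h (corner y)) (lineU U) := by
  funext c
  apply toC_injective_U1
  rw [toC_gaugeAct, toC_lineU, toC_lineU, runC_gaugeAct, ← corner_shift hj]
  rfl

/-- The iterates `u^{(i)} = lineIter U i` (`u^{(0)} = u`, `u^{(i+1)}(Γ_{yy′}) = Π u^{(i)}` over the run): the bond variables of `T^{(j+i)}`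
obtained from `u` by transporting along straight runs of runs — the transports entering the segment `Γ_{x_{i+1},x_i}` of (5.1.3).
[cite: BalabanImbrieJaffe1985, (5.1.2)–(5.1.3) p.313] -/
def lineIter (U : GaugeField P j U1) : (k : ℕ) → GaugeField P (j+k) U1
  | 0 => U
  | k + 1 => lineU (lineIter U k)

/-- kernel: `u^{(0)} = u`. [cite: BalabanImbrieJaffe1985, (5.1.2)–(5.1.3) p.313] -/
@[simp] theorem lineIter_zero (U : GaugeField P j U1) : lineIter U 0 = U := rfl

/-- kernel: `u^{(k+1)} = lineU u^{(k)}`. [cite: BalabanImbrieJaffe1985, (5.1.2)–(5.1.3) p.313] -/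
@[simp] theorem lineIter_succ (U : GaugeField P j U1) (k : ℕ) : lineIter U (k+1) = lineU (lineIter U k) := rfl

/-! ## §2 (5.1.2)–(5.1.3): the block points `x_k`, the iterated blocks `B^k(y)`, corners of corners -/

/-- **(5.1.2)–(5.1.3)** *"x = x₀, y = x_k, … x ∈ B^j(x_j), x_j ∈ T^{(j)}_{L^jη}, that is x_j ∈ B(x_{j+1})"*: `blkIter k x = x_k ∈ T^{(j+k)}`, the
`k`-fold block map of `Setup` (`x_{i+1} = blockOf x_i`). [cite: BalabanImbrieJaffe1985, (5.1.2)–(5.1.3) p.313] -/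
def blkIter : (k : ℕ) → Balaban1983to89.Site P j → Balaban1983to89.Site P (j+k)
  | 0 => fun x => x
  | k + 1 => fun x => blockOf (blkIter k x)

/-- The site `y ∈ T^{(j+k)}` regarded as a site of `T^{(j)}` (*"y = Ln denotes a corner of a block"* (2.4), iterated: the corner of the
corner of …; for `k = 1` r18's `corner`) — the starting point of the composite contour `Γ^{(k)}_{yx}`. [cite: BalabanImbrieJaffe1985, (2.4) p.302] -/
def cornerIter : (k : ℕ) → Balaban1983to89.Site P (j+k) → Balaban1983to89.Site P j
  | 0 => fun y => y
  | k + 1 => fun y => cornerIter k (corner y)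

/-- **`B^k(y)`** = the sites `x` of `T^{(j)}` with `x_k = y` ((5.1.2): `x ∈ B^k(x_k)`). [cite: BalabanImbrieJaffe1985, (5.1.2)–(5.1.3) p.313] -/
def blockK (k : ℕ) (y : Balaban1983to89.Site P (j+k)) : Finset (Balaban1983to89.Site P j) := univ.filter fun x => blkIter k x = y

/-- kernel: `x₀ = x`. [cite: BalabanImbrieJaffe1985, (5.1.2)–(5.1.3) p.313] -/
@[simp] theorem blkIter_zero (x : Balaban1983to89.Site P j) : blkIter 0 x = x := rfl

/-- kernel: `x_{k+1} = blockOf x_k` (*"x_j ∈ B(x_{j+1})"*). [cite: BalabanImbrieJaffe1985, (5.1.2)–(5.1.3) p.313] -/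
@[simp] theorem blkIter_succ (k : ℕ) (x : Balaban1983to89.Site P j) : blkIter (k+1) x = blockOf (blkIter k x) := rfl

/-- kernel: at level `0` the site is itself. [cite: BalabanImbrieJaffe1985, (2.4) p.302] -/
@[simp] theorem cornerIter_zero (y : Balaban1983to89.Site P j) : cornerIter 0 y = y := rfl

/-- kernel: one more level = take r18's `corner` first. [cite: BalabanImbrieJaffe1985, (2.4) p.302] -/
@[simp] theorem cornerIter_succ (k : ℕ) (y : Balaban1983to89.Site P (j+k+1)) : cornerIter (k+1) y = cornerIter k (corner y) := rfl

/-- kernel: `x ∈ B^k(y) ↔ x_k = y`. [cite: BalabanImbrieJaffe1985, (5.1.2)–(5.1.3) p.313] -/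
theorem mem_blockK {k : ℕ} {y : Balaban1983to89.Site P (j+k)} {x : Balaban1983to89.Site P j} : x ∈ blockK k y ↔ blkIter k x = y := by
  simp [blockK]

/-- kernel: `x ∈ B^k(x_k)`. [cite: BalabanImbrieJaffe1985, (5.1.2)–(5.1.3) p.313] -/
theorem mem_blockK_blkIter (k : ℕ) (x : Balaban1983to89.Site P j) : x ∈ blockK k (blkIter k x) := mem_blockK.2 rfl

/-- kernel: `B^0(y) = {y}`. [cite: BalabanImbrieJaffe1985, (5.1.2)–(5.1.3) p.313] -/
theorem blockK_zero (y : Balaban1983to89.Site P j) : blockK 0 y = {y} := by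
  ext x
  rw [mem_blockK, blkIter_zero, mem_singleton]

/-- kernel: **`B^{k+1}(y) = ⋃_{z∈B(y)} B^k(z)`** (*"x_j ∈ B(x_{j+1})"*). [cite: BalabanImbrieJaffe1985, (5.1.2)–(5.1.3) p.313] -/
theorem blockK_succ (k : ℕ) (y : Balaban1983to89.Site P (j+k+1)) : blockK (k+1) y = (block y).biUnion fun z => blockK k z := by
  ext x
  simp only [mem_blockK, mem_biUnion, mem_block_iff, blkIter_succ]
  constructor
  · intro h
    exact ⟨blkIter k x, h, rfl⟩
  · rintro ⟨z, hz, hxz⟩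
    rw [hxz]
    exact hz

/-- kernel: distinct block points have disjoint iterated blocks. [cite: BalabanImbrieJaffe1985, (5.1.2)–(5.1.3) p.313] -/
theorem pairwiseDisjoint_blockK (k : ℕ) (s : Set (Balaban1983to89.Site P (j+k))) :
    s.PairwiseDisjoint fun z => blockK (j := j) k z := by
  intro z _ z' _ hzz'
  exact disjoint_left.2 fun x hx hx' => hzz' ((mem_blockK.1 hx).symm.trans (mem_blockK.1 hx'))

/-- **`|B^k(y)| = L^{kd}`** — the `L^{kd}` points of an iterated block (standing range `j + k ≤ m + K`; r18/`TorusGeometry` `|B(y)| = L^d`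
iterated along `blockK_succ`). [cite: BalabanImbrieJaffe1985, (5.1.2)–(5.1.3) p.313] -/
theorem card_blockK : ∀ (k : ℕ), j + k ≤ P.m + P.K → ∀ y : Balaban1983to89.Site P (j+k), (blockK k y).card = P.L ^ (k * P.d)
  | 0, _, y => by rw [blockK_zero, card_singleton, zero_mul, pow_zero]
  | k + 1, hk, y => by
    have hk' : j + k + 1 ≤ P.m + P.K := by omega
    rw [blockK_succ, card_biUnion (pairwiseDisjoint_blockK k (block y : Set (Balaban1983to89.Site P (j+k)))),
      sum_congr rfl fun z _ => card_blockK k (by omega) z, sum_const, smul_eq_mul,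
      Balaban1983to89.Site.card_block hk' y]
    ring

/-- kernel: the corner point of `y` lies in `B^k(y)`: `(cornerIter k y)_k = y` (r18's `blockOf_corner`, iterated; standing range).
[cite: BalabanImbrieJaffe1985, (2.4) p.302] -/
theorem blkIter_cornerIter : ∀ (k : ℕ), j + k ≤ P.m + P.K → ∀ y : Balaban1983to89.Site P (j+k), blkIter k (cornerIter k y) = y
  | 0, _, _ => rfl
  | k + 1, hk, y => by
    have hk' : j + k + 1 ≤ P.m + P.K := by omega
    rw [cornerIter_succ, blkIter_succ, blkIter_cornerIter k (by omega) (corner y), blockOf_corner hk']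

/-! ## §3 The composite transports `u(Γ^{(k)}_{yx})` and `Q_k(u)` = the `k`-fold composition; the printed formula -/

/-- **`u(Γ^{(k)}_{x_k,x})`** — the transport (2.5) along the composite contour (5.1.3) *"from x to x₁ in B(x₁), from x₁ to x₂ in B(x₂), etc."*:
the product of the one-level transports `u^{(i)}(Γ_{x_{i+1}x_i})` (r18's `holC`, read with the iterate `u^{(i)}` on `T^{(j+i)}`), `i < k`
(abelian group: a product in `ℂ`). [cite: BalabanImbrieJaffe1985, (5.1.2)–(5.1.3) p.313] -/
def holCK (U : GaugeField P j U1) : (k : ℕ) → Balaban1983to89.Site P j → ℂ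
  | 0 => fun _ => 1
  | k + 1 => fun x => holC (lineIter U k) (blkIter k x) * holCK U k x

/-- **`Q_k(u)`**, the `k`-LEVEL covariant scalar block average of (4.6.1)–(4.6.4): *"the k-fold composition of the 1-step averaging
operators"* (p. 309) — `Q_k(u) := Q(u^{(k−1)}) ∘ ⋯ ∘ Q(u^{(1)}) ∘ Q(u)`, each factor r18's (2.6) `qCov` at its level, from scalar fields on
`T^{(j)}` (the `η`-lattice) to scalar fields on `T^{(j+k)}` (the unit lattice). [cite: BalabanImbrieJaffe1985, (4.6.1) p.313] -/
def qCovK (U : GaugeField P j U1) : (k : ℕ) → HiggsField P j → HiggsField P (j+k)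
  | 0 => fun φ => φ
  | k + 1 => fun φ => qCov (lineIter U k) (qCovK U k φ)

/-- kernel: the empty contour transports by `1`. [cite: BalabanImbrieJaffe1985, (2.5) p.302] -/
@[simp] theorem holCK_zero (U : GaugeField P j U1) (x : Balaban1983to89.Site P j) : holCK U 0 x = 1 := rfl

/-- kernel: `u(Γ^{(k+1)}_{x_{k+1},x}) = u^{(k)}(Γ_{x_{k+1}x_k})·u(Γ^{(k)}_{x_k,x})` (composition (2.5) along (5.1.3)).
[cite: BalabanImbrieJaffe1985, (5.1.2)–(5.1.3) p.313] -/
@[simp] theorem holCK_succ (U : GaugeField P j U1) (k : ℕ) (x : Balaban1983to89.Site P j) :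
    holCK U (k+1) x = holC (lineIter U k) (blkIter k x) * holCK U k x := rfl

/-- kernel: `u(Γ^{(1)}_{yx}) = u(Γ_{yx})`. [cite: BalabanImbrieJaffe1985, (2.6) p.303] -/
theorem holCK_one (U : GaugeField P j U1) (x : Balaban1983to89.Site P j) : holCK U 1 x = holC U x := by
  rw [holCK_succ, holCK_zero, mul_one]
  rfl

/-- kernel: `Q_0 = id`. [cite: BalabanImbrieJaffe1985, (4.6.1) p.313] -/
@[simp] theorem qCovK_zero (U : GaugeField P j U1) (φ : HiggsField P j) : qCovK U 0 φ = φ := rfl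

/-- kernel: `Q_{k+1}(u) = Q(u^{(k)}) ∘ Q_k(u)`. [cite: BalabanImbrieJaffe1985, (4.6.1) p.313] -/
@[simp] theorem qCovK_succ (U : GaugeField P j U1) (k : ℕ) (φ : HiggsField P j) :
    qCovK U (k+1) φ = qCov (lineIter U k) (qCovK U k φ) := rfl

/-- kernel: **`Q_1(u) = Q(u)`** — the one-level average IS r18's (2.6). [cite: BalabanImbrieJaffe1985, (2.6) p.303] -/
theorem qCovK_one (U : GaugeField P j U1) (φ : HiggsField P j) : qCovK U 1 φ = qCov U φ := rfl

/-- kernel: `u(Γ^{(k)}_{yx}) ≠ 0`. [cite: BalabanImbrieJaffe1985, (2.5) p.302] -/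
theorem holCK_ne_zero (U : GaugeField P j U1) : ∀ (k : ℕ) (x : Balaban1983to89.Site P j), holCK U k x ≠ 0
  | 0, _ => one_ne_zero
  | k + 1, x => mul_ne_zero (holC_ne_zero _ _) (holCK_ne_zero U k x)

/-- kernel: `|u(Γ^{(k)}_{yx})| = 1`. [cite: BalabanImbrieJaffe1985, (2.5) p.302] -/
theorem norm_holCK (U : GaugeField P j U1) : ∀ (k : ℕ) (x : Balaban1983to89.Site P j), ‖holCK U k x‖ = 1
  | 0, _ => by rw [holCK_zero, norm_one]
  | k + 1, x => by rw [holCK_succ, norm_mul, norm_holC, norm_holCK U k x, one_mul]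

/-- **THE FORMULA FOR `Q_k(u)`** — p. 309 *"It follows that Q_k is given by the formula …, where L is replaced by L^k"*, for the scalar
average (2.6): **`(Q_k(u)φ)(y) = L^{−kd} Σ_{x∈B^k(y)} u(Γ^{(k)}_{yx})φ(x)`**, PROVED from the composition (blocks `B^{k+1}(y) = ⋃_{z∈B(y)}B^k(z)`,
weights `L^{−d}·L^{−kd}`, transports `u^{(k)}(Γ_{yz})u(Γ^{(k)}_{zx}) = u(Γ^{(k+1)}_{yx})`). [cite: BalabanImbrieJaffe1985, (2.6) p.303] -/
theorem qCovK_apply (U : GaugeField P j U1) (φ : HiggsField P j) :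
    ∀ (k : ℕ) (y : Balaban1983to89.Site P (j+k)),
      qCovK U k φ y = ((P.L : ℂ) ^ (k * P.d))⁻¹ * ∑ x ∈ blockK k y, holCK U k x * φ x
  | 0, y => by
    rw [qCovK_zero, blockK_zero, sum_singleton, holCK_zero, one_mul, zero_mul, pow_zero, inv_one, one_mul]
  | k + 1, y => by
    rw [qCovK_succ, qCov_apply, blockK_succ,
      sum_biUnion (pairwiseDisjoint_blockK k (block y : Set (Balaban1983to89.Site P (j+k)))), mul_sum, mul_sum]
    refine sum_congr rfl fun z _ => ?_
    rw [qCovK_apply U φ k z, mul_sum, mul_sum, mul_sum, mul_sum]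
    refine sum_congr rfl fun x hx => ?_
    rw [holCK_succ, mem_blockK.1 hx,
      show ((P.L : ℂ) ^ ((k + 1) * P.d))⁻¹ = ((P.L : ℂ) ^ P.d)⁻¹ * ((P.L : ℂ) ^ (k * P.d))⁻¹ by
        rw [add_mul, one_mul, pow_add, mul_inv, mul_comm]]
    ring

/-! ### (2.8) at level `k`; the axial-gauge reduction at level `k` -/

/-- kernel: (2.7) for the iterates: `lineIter (u^h) k = (lineIter u k)^{h ∘ cornerIter k}` (standing range `j + k ≤ m + K`).
[cite: BalabanImbrieJaffe1985, (2.8) p.303] -/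
theorem lineIter_gaugeAct (h : GaugeTransf P j U1) (U : GaugeField P j U1) :
    ∀ k : ℕ, j + k ≤ P.m + P.K → lineIter (gaugeAct h U) k = gaugeAct (fun y => h (cornerIter k y)) (lineIter U k)
  | 0, _ => rfl
  | k + 1, hk => by
    have hk' : j + k + 1 ≤ P.m + P.K := by omega
    rw [lineIter_succ, lineIter_succ, lineIter_gaugeAct h U k (by omega), lineU_gaugeAct hk']
    rfl

/-- **(2.8) at level `k`**: *"Clearly (Qφ)^h = Qφ^h"* for the `k`-fold composition — `Q_k(u^h)φ^h = (Q_k(u)φ)^h`, the transformed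
average being multiplied by `h` at the corner point of the coarse site `y` (standing range; r18's one-level `qCov_gaugeAct` iterated with
`lineIter_gaugeAct`). [cite: BalabanImbrieJaffe1985, (2.8) p.303] -/
theorem qCovK_gaugeAct (h : GaugeTransf P j U1) (U : GaugeField P j U1) (φ : HiggsField P j) :
    ∀ (k : ℕ), j + k ≤ P.m + P.K → ∀ y : Balaban1983to89.Site P (j+k),
      qCovK (gaugeAct h U) k (fun x => toC (h x) * φ x) y = toC (h (cornerIter k y)) * qCovK U k φ y
  | 0, _, _ => rfl
  | k + 1, hk, y => by
    have hk' : j + k + 1 ≤ P.m + P.K := by omega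
    have ih : qCovK (gaugeAct h U) k (fun x => toC (h x) * φ x) = fun z => toC (h (cornerIter k z)) * qCovK U k φ z :=
      funext fun z => qCovK_gaugeAct h U φ k (by omega) z
    rw [qCovK_succ, qCovK_succ, ih, lineIter_gaugeAct h U k (by omega), qCov_gaugeAct hk']
    rfl

/-- kernel: in the `k`-level axial gauge (every iterate `u^{(i)}`, `i < k`, equals `1` on the tree bonds of its level — r18's `DeltaAx`) the
composite transports are `1` (r18's `holC_of_deltaAx` at each level; standing range). [cite: BalabanImbrieJaffe1985, (2.6) p.303] -/
theorem holCK_of_deltaAx (U : GaugeField P j U1) :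
    ∀ (k : ℕ), j + k ≤ P.m + P.K → (∀ i < k, DeltaAx (lineIter U i)) → ∀ x : Balaban1983to89.Site P j, holCK U k x = 1
  | 0, _, _, _ => rfl
  | k + 1, hk, hAx, x => by
    have hk' : j + k + 1 ≤ P.m + P.K := by omega
    rw [holCK_succ, holC_of_deltaAx hk' (hAx k (Nat.lt_succ_self k)),
      holCK_of_deltaAx U k (by omega) (fun i hi => hAx i (Nat.lt_succ_of_lt hi)) x, one_mul]

/-- p. 303 *"In the axial gauge, Qφ reduces to the ordinary average of φ"* AT LEVEL `k`: `(Q_k(u)φ)(y) = L^{−kd} Σ_{x∈B^k(y)} φ(x)` when every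
iterate `u^{(i)}`, `i < k`, is `1` on the tree bonds of its level (standing range). [cite: BalabanImbrieJaffe1985, (2.6) p.303] -/
theorem qCovK_of_deltaAx (U : GaugeField P j U1) {k : ℕ} (hk : j + k ≤ P.m + P.K) (hAx : ∀ i < k, DeltaAx (lineIter U i))
    (φ : HiggsField P j) (y : Balaban1983to89.Site P (j+k)) :
    qCovK U k φ y = ((P.L : ℂ) ^ (k * P.d))⁻¹ * ∑ x ∈ blockK k y, φ x := by
  rw [qCovK_apply]
  congr 1
  exact sum_congr rfl fun x _ => by rw [holCK_of_deltaAx U k hk hAx x, one_mul]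

/-! ## §4 `Q_k(u)` as a real-linear map of the `ℓ²` spaces -/

/-- Unit-lattice (level `j + k`) scalar fields `ψ` with the `ℓ²` product (weight `1` in (2.2); for `k = 1` the `CoarseSp` of
`BIJ85ScalarPropagatorTorus`). [cite: BalabanImbrieJaffe1985, (2.2) p.302] -/
abbrev CoarseSpK (P : Params) (j k : ℕ) : Type := PiLp 2 (fun _ : Balaban1983to89.Site P (j+k) => ℂ)

/-- `Q_k(u)` as a real-linear map `φ ↦ Q_k(u)φ` (linear: the formula `qCovK_apply`). [cite: BalabanImbrieJaffe1985, (4.6.1) p.313] -/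
def QlinK (U : GaugeField P j U1) (k : ℕ) : FineSp P j →ₗ[ℝ] CoarseSpK P j k where
  toFun φ := WithLp.toLp 2 (qCovK U k (WithLp.ofLp φ))
  map_add' φ φ' := by
    ext y
    simp only [PiLp.add_apply, qCovK_apply, WithLp.ofLp_add, Pi.add_apply, mul_add, sum_add_distrib]
  map_smul' r φ := by
    ext y
    simp only [PiLp.smul_apply, qCovK_apply, WithLp.ofLp_smul, Pi.smul_apply, RingHom.id_apply, Complex.real_smul,
      mul_sum]
    exact sum_congr rfl fun x _ => by ring

/-- kernel: the value of `QlinK`. [cite: BalabanImbrieJaffe1985, (4.6.1) p.313] -/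
@[simp] theorem QlinK_apply (U : GaugeField P j U1) (k : ℕ) (φ : FineSp P j) (y : Balaban1983to89.Site P (j+k)) :
    QlinK U k φ y = qCovK U k (WithLp.ofLp φ) y := rfl

/-- kernel: **at `k = 1` this IS the one-level map `Qlin` of `BIJ85ScalarPropagatorTorus`**. [cite: BalabanImbrieJaffe1985, (2.6) p.303] -/
theorem QlinK_one (U : GaugeField P j U1) : QlinK U 1 = Qlin U := LinearMap.ext fun _ => rfl

/-- `‖Q_k(u)φ − ψ‖² = Σ_y |(Q_k(u)φ)(y) − ψ(y)|²`. [cite: BalabanImbrieJaffe1985, (4.6.1) p.313] -/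
theorem norm_QlinK_sub_sq (U : GaugeField P j U1) (k : ℕ) (φ : FineSp P j) (ψ : CoarseSpK P j k) :
    ‖QlinK U k φ - ψ‖ ^ 2 = ∑ y : Balaban1983to89.Site P (j+k), ‖qCovK U k (WithLp.ofLp φ) y - ψ y‖ ^ 2 := by
  rw [PiLp.norm_sq_eq_of_L2]
  rfl

/-- The abstract form (3.25)/(the exponent of (4.6.1) with source `ψ`) of `BIJ85ScalarForm464` IS the printed level-`k` expression on the
torus: `½aΣ_y|(Q_k(u)φ)(y) − ψ(y)|² + ½Σ_b|c(u_bφ(b₊) − φ(b₋))|²`. [cite: BalabanImbrieJaffe1985, (4.6.1) p.313] -/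
theorem scalarForm_torusK (c a : ℝ) (U : GaugeField P j U1) (k : ℕ) (ψ : CoarseSpK P j k) (φ : FineSp P j) :
    BIJ85ScalarForm464.scalarForm (Dlin c U) (QlinK U k) a ψ φ
      = (1 / 2 : ℝ) * a * (∑ y : Balaban1983to89.Site P (j+k), ‖qCovK U k (WithLp.ofLp φ) y - ψ y‖ ^ 2)
        + (1 / 2 : ℝ) * ∑ b : PBond P j, ‖(c : ℂ) * (toC (U b) * φ b.tgt - φ b.src)‖ ^ 2 := by
  rw [BIJ85ScalarForm464.scalarForm, norm_QlinK_sub_sq, norm_Dlin_sq]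

/-! ## §5 (v1.1) (2.9) `Q_kQ_k^* = I` for the `k`-level average: r15's two-scale cell geometry at block size `L^k` -/

/-- The composite transport `u(Γ^{(k)}_{yx})` as an element of the unit circle (the `τ_x` of r15's `BIJ85CellAverages.Cells.Qcov`).
[cite: BalabanImbrieJaffe1985, (2.6) p.303] -/
def holCKCircle (U : GaugeField P j U1) (k : ℕ) (x : Balaban1983to89.Site P j) : Circle :=
  ⟨holCK U k x, mem_sphere_zero_iff_norm.2 (norm_holCK U k x)⟩

/-- kernel: `holCKCircle` read in `ℂ` is `holCK`. [cite: BalabanImbrieJaffe1985, (2.6) p.303] -/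
@[simp] theorem coe_holCKCircle (U : GaugeField P j U1) (k : ℕ) (x : Balaban1983to89.Site P j) :
    (holCKCircle U k x : ℂ) = holCK U k x := rfl

/-- **The two-scale cell geometry of `Q_k` on the torus** — an instance of r15's `BIJ85CellAverages.Cells`: fine cells = sites of `T^{(j)}`,
coarse cells = sites of `T^{(j+k)}`, `x ∈ B^k(x_k)`, block size `L^k` (*"where L is replaced by L^k"*), exponent `m = 0`, dimension `d`
(for `k = 1` this is r18's `torusCells`). [cite: BalabanImbrieJaffe1985, (2.6) p.303] -/
def torusCellsK (P : Params) (j k : ℕ) : BIJ85CellAverages.Cells where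
  F := Balaban1983to89.Site P j
  C := Balaban1983to89.Site P (j+k)
  cell := fun x => some (blkIter k x)
  L := P.L ^ k
  d := P.d
  m := 0
  one_le_L := Nat.one_le_pow _ _ P.L_pos
  m_le_d := Nat.zero_le _

/-- kernel: the block sets of `torusCellsK` are the iterated blocks `B^k(y)`. [cite: BalabanImbrieJaffe1985, (5.1.2)–(5.1.3) p.313] -/
theorem torusCellsK_B (k : ℕ) (y : Balaban1983to89.Site P (j+k)) : (torusCellsK P j k).B y = blockK k y := by
  ext x
  rw [BIJ85CellAverages.Cells.mem_B]
  show some (blkIter k x) = some y ↔ x ∈ blockK k y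
  exact Option.some_inj.trans mem_blockK.symm

/-- kernel: the weight `(L^k)^d = L^{kd}` of the cell geometry. [cite: BalabanImbrieJaffe1985, (2.6) p.303] -/
theorem torusCellsK_weight (k : ℕ) : (((torusCellsK P j k).L : ℂ) ^ (torusCellsK P j k).d) = (P.L : ℂ) ^ (k * P.d) := by
  show ((P.L ^ k : ℕ) : ℂ) ^ P.d = _
  rw [Nat.cast_pow, ← pow_mul]

/-- kernel: **`Q_k(u)` IS r15's cell average at block size `L^k`** with the transports `u(Γ^{(k)}_{yx})`: `qCovK U k φ = Cells.Qcov (holCKCircle U k) φ`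
(`qCovK_apply`). [cite: BalabanImbrieJaffe1985, (2.6) p.303] -/
theorem qCovK_eq_cellsQcov (U : GaugeField P j U1) (k : ℕ) (φ : HiggsField P j) (y : Balaban1983to89.Site P (j+k)) :
    qCovK U k φ y = (torusCellsK P j k).Qcov (holCKCircle U k) φ y := by
  rw [qCovK_apply, BIJ85CellAverages.Cells.Qcov, torusCellsK_B, torusCellsK_weight]
  rfl

/-- **(2.9) at level `k`**: *"A further property of Q is that QQ^* = I, (2.9) where Q^* is the adjoint in the scalar product (2.2)"* — for
the `k`-fold composition: `Q_k(u)(Q_k(u)^*ψ) = ψ` with `Q_k(u)^*` = r15's `Cells.QcovStar` at block size `L^k` (the adjoint for the weights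
(2.2): `inner_qCovK_eq_inner_qCovKStar`), from r15's `Cells.Qcov_QcovStar` and `|B^k(y)| = (L^k)^d` (`card_blockK`; standing range
`j + k ≤ m + K`). [cite: BalabanImbrieJaffe1985, (2.9) p.303] -/
theorem qCovK_qCovKStar {k : ℕ} (hk : j + k ≤ P.m + P.K) (U : GaugeField P j U1) (ψ : HiggsField P (j+k))
    (y : Balaban1983to89.Site P (j+k)) :
    qCovK U k ((torusCellsK P j k).QcovStar (holCKCircle U k) ψ) y = ψ y := by
  have hcard : ∀ y' : Balaban1983to89.Site P (j+k),
      ((torusCellsK P j k).B y').card = (torusCellsK P j k).L ^ (torusCellsK P j k).d := fun y' => by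
    rw [torusCellsK_B]
    show (blockK k y').card = (P.L ^ k) ^ P.d
    rw [card_blockK k hk, pow_mul]
  rw [qCovK_eq_cellsQcov]
  exact (torusCellsK P j k).Qcov_QcovStar hcard _ ψ y

/-- kernel: `Q_k(u)^*` IS the adjoint of `Q_k(u)` for the scalar products (2.2) (weight `L^{kd}` on `T^{(j+k)}` relative to `1` on `T^{(j)}`:
`η = L^{−k}`) — r15's `Cells.inner_Qcov_eq_inner_QcovStar` on the level-`k` torus instance. [cite: BalabanImbrieJaffe1985, (2.9) p.303] -/
theorem inner_qCovK_eq_inner_qCovKStar (U : GaugeField P j U1) (k : ℕ) (φ : HiggsField P j) (ψ : HiggsField P (j+k)) :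
    BIJ85CellAverages.Cells.innerC ((P.L : ℂ) ^ (k * P.d)) (qCovK U k φ) ψ =
      BIJ85CellAverages.Cells.innerC 1 φ ((torusCellsK P j k).QcovStar (holCKCircle U k) ψ) := by
  have e : qCovK U k φ = (torusCellsK P j k).Qcov (holCKCircle U k) φ := funext fun y => qCovK_eq_cellsQcov U k φ y
  rw [e, ← torusCellsK_weight]
  exact (torusCellsK P j k).inner_Qcov_eq_inner_QcovStar (holCKCircle U k) φ ψ

end

end Literature.MathematicalPhysics.QuantumFieldTheory.BalabanImbrieJaffe1984to88.BIJ85BlockAveragesTorusK
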